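import Mathlib
import Summits.KontsevichZagierPeriods.Zeta5Search.ThirdOrderAggregate
import Summits.KontsevichZagierPeriods.Zeta5Search.ThirdOrderTransfer
import HarnessLib

/-!
# ζ(5) search — THEOREM A⁗ (`SecondOrder.LawA4`, gen-2 g10) IS A THEOREM: `v_p(Cas_j(b)) ≥ 7 − 2M`

Cell `pub-zeta5` (HONEST FRAMING: systematic search; no irrationality claim unless certified), typer seat generation 12.
Discharges BY NAME `SecondOrder.LawA4` of `Zeta5Search/ThirdOrderDigit.lean` (REPORT-gen2-g10 §6.5, THEOREM A⁗ one-type form): under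
the hypotheses of THEOREM A‴ plus (T3) "every pole class with `ν = −M+2` is an admissible double raise of `T`", the Casoratian gains a
fourth order of magnitude: `v_p(Cas_j(b)) ≥ 7 − 2M = casLB + 4`.
Proof: `aggregate₄` (file `ThirdOrderAggregate`: the three pair identities P0/P1/P2 to relative order `p²`, assembled by the conjugation
symmetrisation) for `b` and — after transporting the hypotheses (`H1_shift`–`H4_shift` of typer g11, `H5_shift`) — for `b + e_j`
gives `2(w, v) ≡ A·τ(T)`, `2(w', v') ≡ A'·τ(T) (mod p³)` with `‖Aτ‖, ‖A'τ‖ ≤ p⁻¹` and the SAME direction `τ(T)`; hence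
`4(w'v − wv') ≡ (A'τ_W)(Aτ_V) − (Aτ_W)(A'τ_V) = 0 (mod p⁴)` (`det₄`), and `Cas = (−p)^{2m+3}(w'v − wv')`.
`p`-adic valuations of rational numbers; nothing here concerns irrationality.
-/

noncomputable section

open Finset PowerSeries

namespace Summit.KontsevichZagierPeriods.Zeta5Search.SecondOrder

open Summit.KontsevichZagierPeriods.Zeta5Search.DualSeries (InBox)
open Summit.KontsevichZagierPeriods.Zeta5Search.WedgeDictionary (coeffW coeffV)
open Summit.KontsevichZagierPeriods.Zeta5Search.CasoratianValuation (InPolytope shift casoratian)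
open Summit.KontsevichZagierPeriods.Zeta5Search.ClusterValuation
open Summit.KontsevichZagierPeriods.Zeta5Search.PadicSeries
open Summit.KontsevichZagierPeriods.Zeta5Search.BigPrime (shift_zero padicNorm_mul_le_one)

variable {p : ℕ} [hp : Fact p.Prime]

/-! ## §1 The determinant estimate -/

/-- **Third-order collinearity kills three digits**: if `2w ≡ At_W`, `2v ≡ At_V`, `2w' ≡ A't_W`, `2v' ≡ A't_V (mod p³)` with
`‖At‖, ‖A't‖ ≤ p⁻¹` (componentwise), then `‖w'v − wv'‖ ≤ p⁻⁴`. -/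
theorem det₄ (hp2 : p ≠ 2) {w v w' v' A A' tW tV : ℚ}
    (hw : padicNorm p (2 * w - A * tW) ≤ (p : ℚ) ^ (-(3 : ℤ))) (hv : padicNorm p (2 * v - A * tV) ≤ (p : ℚ) ^ (-(3 : ℤ)))
    (hw' : padicNorm p (2 * w' - A' * tW) ≤ (p : ℚ) ^ (-(3 : ℤ))) (hv' : padicNorm p (2 * v' - A' * tV) ≤ (p : ℚ) ^ (-(3 : ℤ)))
    (hAW : padicNorm p (A * tW) ≤ (p : ℚ) ^ (-(1 : ℤ))) (hAV : padicNorm p (A * tV) ≤ (p : ℚ) ^ (-(1 : ℤ)))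
    (hAW' : padicNorm p (A' * tW) ≤ (p : ℚ) ^ (-(1 : ℤ))) (hAV' : padicNorm p (A' * tV) ≤ (p : ℚ) ^ (-(1 : ℤ))) :
    padicNorm p (w' * v - w * v') ≤ (p : ℚ) ^ (-(4 : ℤ)) := by
  have hpQ : (p : ℚ) ≠ 0 := Nat.cast_ne_zero.2 hp.out.ne_zero
  have hp1 : (1 : ℚ) ≤ p := by exact_mod_cast hp.out.one_le
  have h4 : padicNorm p ((1 : ℚ) / 4) = 1 := by
    rw [show ((1 : ℚ) / 4) = 1 / (2 * 2) by norm_num, padicNorm.div, padicNorm.one, padicNorm.mul, padicNorm_two hp2]; norm_num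
  set r₁ := 2 * w - A * tW
  set r₂ := 2 * v - A * tV
  set r₃ := 2 * w' - A' * tW
  set r₄ := 2 * v' - A' * tV
  have hexp : w' * v - w * v' = (1 : ℚ) / 4 * ((r₃ * r₂ - r₁ * r₄) + (r₃ * (A * tV) + (A' * tW) * r₂ - r₁ * (A' * tV) - (A * tW) * r₄)) := by
    simp only [r₁, r₂, r₃, r₄]; ring
  have hrr : ∀ {a c : ℚ}, padicNorm p a ≤ (p : ℚ) ^ (-(3 : ℤ)) → padicNorm p c ≤ (p : ℚ) ^ (-(3 : ℤ)) →
      padicNorm p (a * c) ≤ (p : ℚ) ^ (-(4 : ℤ)) := fun ha hc => by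
    rw [padicNorm.mul]
    calc _ ≤ (p : ℚ) ^ (-(3 : ℤ)) * (p : ℚ) ^ (-(3 : ℤ)) := mul_le_mul ha hc (padicNorm.nonneg _) (zpow_p_nonneg _)
      _ = (p : ℚ) ^ (-(6 : ℤ)) := by rw [← zpow_add₀ hpQ]; norm_num
      _ ≤ _ := zpow_le_zpow_right₀ hp1 (by norm_num)
  have hra : ∀ {a c : ℚ}, padicNorm p a ≤ (p : ℚ) ^ (-(3 : ℤ)) → padicNorm p c ≤ (p : ℚ) ^ (-(1 : ℤ)) →
      padicNorm p (a * c) ≤ (p : ℚ) ^ (-(4 : ℤ)) := fun ha hc => by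
    rw [padicNorm.mul]
    calc _ ≤ (p : ℚ) ^ (-(3 : ℤ)) * (p : ℚ) ^ (-(1 : ℤ)) := mul_le_mul ha hc (padicNorm.nonneg _) (zpow_p_nonneg _)
      _ = (p : ℚ) ^ (-(4 : ℤ)) := by rw [← zpow_add₀ hpQ]; norm_num
  have har : ∀ {a c : ℚ}, padicNorm p a ≤ (p : ℚ) ^ (-(1 : ℤ)) → padicNorm p c ≤ (p : ℚ) ^ (-(3 : ℤ)) →
      padicNorm p (a * c) ≤ (p : ℚ) ^ (-(4 : ℤ)) := fun ha hc => by rw [mul_comm]; exact hra hc ha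
  rw [hexp, padicNorm.mul, h4, one_mul]
  refine (padicNorm.nonarchimedean (p := p)).trans (max_le ?_ ?_)
  · exact (padicNorm.sub (p := p)).trans (max_le (hrr hw' hv) (hrr hw hv'))
  · have k1 := hra hw' hAV
    have k2 := har hAW' hv
    have k3 := hra hw hAV'
    have k4 := har hAW hv'
    have s2 := (padicNorm.nonarchimedean (p := p)).trans (max_le k1 k2)
    have s3 := (padicNorm.sub (p := p)).trans (max_le s2 k3)
    exact (padicNorm.sub (p := p)).trans (max_le s3 k4)

/-! ## §2 THEOREM A⁗ -/

/-- **THEOREM A⁗ (`LawA4`, gen-2 g10) is a theorem.** -/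
theorem lawA4_holds : LawA4 := by
  intro b p j M T hb hb' hj1 hj7 hprime hp5 hpb hwin hM hMe hT H1 H2 H3 H4 H5 hcas
  haveI : Fact p.Prime := ⟨hprime⟩
  have hp0 : (p : ℚ) ≠ 0 := Nat.cast_ne_zero.2 hprime.ne_zero
  have hpneg : (-(p : ℚ)) ≠ 0 := neg_ne_zero.2 hp0
  have hp2 : p ≠ 2 := by omega
  -- the aggregates for `b` and `b + e_j`
  obtain ⟨A, ⟨hAW, hAV⟩, hW, hV⟩ := aggregate₄ b hb hp5 hpb hwin hM hMe hT H1 H2 H3 H4 H5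
  have hpb' : (p : ℤ) ≤ shift b j 0 := by rw [shift_zero b hj1]; exact hpb
  have hwin' : (shift b j 0 + 2 : ℤ) < (p : ℤ) ^ 2 := by rw [shift_zero b hj1]; exact hwin
  have H4' := H4_shift b hb hb' hj1 hj7 hpb hM H1 H2 H3 H4
  have H5' := H5_shift b hb hb' hj1 hj7 hpb hM H1 H2 H3 H4 H5
  obtain ⟨A', ⟨hAW', hAV'⟩, hW', hV'⟩ := aggregate₄ (shift b j) hb' hp5 hpb' hwin' hM hMe hT
    (H1_shift b hb hj1 H1) (H2_shift b hb hb' hj1 hj7 hM H1 H2) (H3_shift b hb hb' hj1 hj7 hpb H1 H3) H4' H5'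
  -- the minor
  set w := coeffW b / (-(p : ℚ)) ^ (-(M : ℤ) + 3)
  set v := coeffV b / (-(p : ℚ)) ^ (-(M : ℤ))
  set w' := coeffW (shift b j) / (-(p : ℚ)) ^ (-(M : ℤ) + 3)
  set v' := coeffV (shift b j) / (-(p : ℚ)) ^ (-(M : ℤ))
  have hdet := det₄ hp2 hW hV hW' hV' hAW hAV hAW' hAV'
  have hcasE : casoratian b j = (-(p : ℚ)) ^ (-(M : ℤ) + 3) * (-(p : ℚ)) ^ (-(M : ℤ)) * (w' * v - w * v') := by
    have e1 : coeffW b = w * (-(p : ℚ)) ^ (-(M : ℤ) + 3) := by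
      simp only [w]; rw [div_mul_cancel₀ _ (zpow_ne_zero _ hpneg)]
    have e2 : coeffV b = v * (-(p : ℚ)) ^ (-(M : ℤ)) := by
      simp only [v]; rw [div_mul_cancel₀ _ (zpow_ne_zero _ hpneg)]
    have e3 : coeffW (shift b j) = w' * (-(p : ℚ)) ^ (-(M : ℤ) + 3) := by
      simp only [w']; rw [div_mul_cancel₀ _ (zpow_ne_zero _ hpneg)]
    have e4 : coeffV (shift b j) = v' * (-(p : ℚ)) ^ (-(M : ℤ)) := by
      simp only [v']; rw [div_mul_cancel₀ _ (zpow_ne_zero _ hpneg)]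
    unfold casoratian
    rw [e1, e2, e3, e4]; ring
  apply val_ge_of_padicNorm_le hcas
  rw [hcasE, padicNorm.mul, padicNorm.mul, LevelClass.padicNorm_neg_p_zpow, LevelClass.padicNorm_neg_p_zpow]
  calc (p : ℚ) ^ (-(-(M : ℤ) + 3)) * (p : ℚ) ^ (-(-(M : ℤ))) * padicNorm p (w' * v - w * v')
      ≤ (p : ℚ) ^ (-(-(M : ℤ) + 3)) * (p : ℚ) ^ (-(-(M : ℤ))) * (p : ℚ) ^ (-(4 : ℤ)) :=
        mul_le_mul_of_nonneg_left hdet (mul_nonneg (zpow_p_nonneg _) (zpow_p_nonneg _))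
    _ = (p : ℚ) ^ (-((7 : ℤ) - 2 * M)) := by
        rw [← zpow_add₀ hp0, ← zpow_add₀ hp0]; congr 1; ring

end Summit.KontsevichZagierPeriods.Zeta5Search.SecondOrder

end
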